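import Literature.Barriers.CriticalPhenomena.LaceExpansionXSpaceAsymptotics
import Literature.Barriers.CriticalPhenomena.KozmaNachmiasOneArm
import HarnessLib

/-!
# `ρ_ex = 1/2` for `d ≥ 11` (Heydenreich–van der Hofstad 2017, Thm. 11.5 (11.3.2)): the named fact
# `KozmaNachmias2011_rhoExHalf` assembled from the current leaves of its decomposition

Barrier catalogue `Literature/Barriers/CriticalPhenomena/` (D-0021), companion of
`LaceExpansionHighDimension.lean` (conjunct `PercolationContinuityZ3`), which vendors Thm. 11.5
(11.3.2) — `c_ex/n² ≤ P_{p_c}(0 ↔ ∂Λ_n) ≤ C_ex/n²` for `d ≥ 11` (Kozma–Nachmias 2011) — as the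
named fact `KozmaNachmias2011_rhoExHalf : ∀ d ≥ 11, RhoExHalf d`. Its printed proof has two inputs
("The proof of (11.3.2) crucially relies on Thm. 11.4", ibid. p. 139): Thm. 11.4 (`η = 0` in
`x`-space, the lace expansion) and Kozma–Nachmias's Thm. 1 (conditional version, §1.1). The tree
decomposes both:

* `LaceExpansionHighDimensionProofs.lean`: the lower half of (11.3.2) PROVED from the two-point
  bounds (Kozma–Nachmias Lemmas 2.1–2.2), and
  `KozmaNachmias2011_rhoExHalf_of : Hara2008_etaZeroXSpace → KozmaNachmias2011_oneArmUpper → …`;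
* `LaceExpansionXSpaceAsymptotics.lean`: `Hara2008_etaZeroXSpace_of_framework :
  Hara2008_gaussianConvolution → Hara2008_laceExpansionPc → Hara2008_etaZeroXSpace` (Hara 2008,
  §1.2: the Gaussian lemma, pure analysis, and the lace-expansion input at `p_c` for `d ≥ 11`,
  computer-assisted below `d = 19`);
* `KozmaNachmiasOneArm.lean`: `KozmaNachmias2011_oneArmUpper_of_lemma23 :
  KozmaNachmias2011_lemma23 → KozmaNachmias2011_oneArmUpper` (the induction of Kozma–Nachmias 2011,
  §2, p. 384, PROVED), Lemma 2.3 being in turn printed from (1.1) (`KozmaNachmias2011_volumeTail`,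
  discharged modulo `γ = 1` in `KozmaNachmiasVolumeTail.lean`) and Thm. 2 (`KozmaNachmias2011_thm2`).

This file only composes these: after it, the trust base of `KozmaNachmias2011_rhoExHalf` is
{`Hara2008_gaussianConvolution`, `Hara2008_laceExpansionPc`, `KozmaNachmias2011_lemma23`}
(`KozmaNachmias2011_rhoExHalf_of_framework`). No new definitions or named facts.

## References

* M. Heydenreich, R. van der Hofstad, *Progress in High-Dimensional Percolation and Random
  Graphs*, Springer 2017: Thm. 11.4 (p. 137), Thm. 11.5 (11.3.2) and p. 139, §11.3.2 (pp. 143–144).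
* G. Kozma, A. Nachmias, J. Amer. Math. Soc. 24 (2011) 375–409: Thm. 1 (conditional version,
  §1.1), Lemma 2.3, proof of Thm. 1 (§2).
* T. Hara, Ann. Probab. 36 (2008) 530–593, Thm. 1.1, Prop. 1.2, Cor. 1.4.
-/

noncomputable section

namespace Literature.Barriers.CriticalPhenomena

variable {d : ℕ}

/-- **Thm. 11.5 (11.3.2) from Thm. 11.4 and Kozma–Nachmias's Lemma 2.3**: the named fact
`KozmaNachmias2011_rhoExHalf` follows from `Hara2008_etaZeroXSpace` (Thm. 11.4) and the recursive
inequality `KozmaNachmias2011_lemma23` (the lower bound and the induction from Lemma 2.3 being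
proved in the tree). [cite: HeydenreichVanDerHofstad2017, Thm. 11.5 (11.3.2) and p. 139]
[cite: KozmaNachmias2011, Lemma 2.3 and §2 (proof of Thm. 1)] -/
theorem KozmaNachmias2011_rhoExHalf_of_lemma23 (h₁ : Hara2008_etaZeroXSpace)
    (h₂ : KozmaNachmias2011_lemma23) : KozmaNachmias2011_rhoExHalf :=
  KozmaNachmias2011_rhoExHalf_of h₁ (KozmaNachmias2011_oneArmUpper_of_lemma23 h₂)

/-- **Thm. 11.5 (11.3.2) from the current leaves of its decomposition**: Hara's Gaussian lemma
(`Hara2008_gaussianConvolution`), the lace-expansion input at `p_c` for `d ≥ 11`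
(`Hara2008_laceExpansionPc`) and Kozma–Nachmias's Lemma 2.3 (`KozmaNachmias2011_lemma23`) imply
`KozmaNachmias2011_rhoExHalf`; everything else on the printed route (Hara 2008, §1.2.2–1.2.3; the
second-moment lower bound; the induction of Kozma–Nachmias 2011, §2) is proved in the tree.
[cite: HeydenreichVanDerHofstad2017, Thm. 11.4 and Thm. 11.5 (11.3.2)] -/
theorem KozmaNachmias2011_rhoExHalf_of_framework (hG : Hara2008_gaussianConvolution)
    (hP : Hara2008_laceExpansionPc) (hL : KozmaNachmias2011_lemma23) :
    KozmaNachmias2011_rhoExHalf :=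
  KozmaNachmias2011_rhoExHalf_of_lemma23 (Hara2008_etaZeroXSpace_of_framework hG hP) hL

/-- In particular, from the same three leaves, `ρ_ex = 1/2` in the bounded-ratio sense
(`RhoExHalf d`) in every dimension `d ≥ 11`. [cite: HeydenreichVanDerHofstad2017, Thm. 11.5 (11.3.2)] -/
theorem rhoExHalf_of_framework (hG : Hara2008_gaussianConvolution) (hP : Hara2008_laceExpansionPc)
    (hL : KozmaNachmias2011_lemma23) (hd : 11 ≤ d) : RhoExHalf d :=
  KozmaNachmias2011_rhoExHalf_of_framework hG hP hL d hd

end Literature.Barriers.CriticalPhenomena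

end
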